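import Summits.Ventures.AbcSig.Rows.TemplateC2a
import Summits.Ventures.AbcSig.Levels.N454
import Summits.Ventures.AbcSig.Levels.N7264

/-!
# Venture AbcSig — ROW `C2aL227A3`: `xⁿ + 2^a·227^m·yⁿ = z²`, class `a 3` (GENERATED by plean/leanrow.py)

HONEST FRAMING. A row of a COMPUTATION cell (`pub-abcsig`); a CONDITIONAL theorem, no claim on ABC or any summit.
Hypotheses: `BS04Package` (CITED), `DataComplete` at levels [454, 7264] (COMPUTED, two-engine certified
level files), and the listed per-orbit exclusions `hX_…` (CITED; the
row's R5 cell names each). Everything else is kernel-checked (`Rows/TemplateC2a.lean`, `Levels/N….lean`). Exponent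
range: prime `n ≥ 11`, `n ≠ 227`; `B = 2^a 227^m` with `a, m < n` (n-th-power free).
Row of record: `census/rows/C2a/C2a-l227-a3.md` (sha256 `ace116f33ff50463…`; SIGNED 2026-08-22T12:17:58Z by referee (ref-g8)); its R0: THEOREM (uses CITED arithmetic facts) for all primes n >= 11 with n coprime to 1816 — class: candidate (a ∈ {0,3} cell, BATCH-03; lit/COVERAGE §C2 + I–K 2006 Th. Exponents left open by the row of record are excluded here via `hres`; kernel-sieve residuals the row of record closes by a cell module (M6 Eisenstein / M4 Kraus certificates) appear as CITED hypotheses `hX_…`.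
-/

namespace Summit.Ventures.AbcSig

/-- Row `C2aL227A3` (see module docstring). -/
theorem row_C2aL227A3 (M : NewformModel) (hP : M.BS04Package)
    (hD454 : M.DataComplete 454 level454Orbits) (hD7264 : M.DataComplete 7264 level7264Orbits)
    (n : ℕ) (hn : n.Prime) (hmin : 11 ≤ n) (hnℓ : n ≠ 227) (m : ℕ) (hm : 1 ≤ m) (hmn : m < n)
    (hX_orbit_454_4 : n ∈ ([7, 19] : List ℕ) → M.Excludes 454 orbit_454_4 (famB (2 ^ 3 * 227 ^ m) n (fun _ _ => True)))
    (hX_orbit_7264_7 : n ∈ ([7, 19] : List ℕ) → M.Excludes 7264 orbit_7264_7 (famB (2 ^ 3 * 227 ^ m) n (fun _ _ => True)))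
    (hX_orbit_7264_8 : n ∈ ([7, 19] : List ℕ) → M.Excludes 7264 orbit_7264_8 (famB (2 ^ 3 * 227 ^ m) n (fun _ _ => True)))
    (x y z : ℤ) (hxy1 : x * y ≠ 1) (hxy2 : x * y ≠ -1) : ¬ IsPrimitiveSolution 1 (2 ^ 3 * 227 ^ m) 1 n x y z := by
  have hℓ : Nat.Prime 227 := by norm_num
  have h7 : 7 ≤ n := by omega
  have hS454 :=
    (level454_sieve n hn h7 (fun o => M.Excludes 454 o (famB (2 ^ 3 * 227 ^ m) n (fun _ _ => True))) (fun h => absurd h (by simp only [List.mem_cons, List.not_mem_nil, or_false]; omega)) hX_orbit_454_4)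
  have hS7264 :=
    (level7264_sieve n hn h7 (fun o => M.Excludes 7264 o (famB (2 ^ 3 * 227 ^ m) n (fun _ _ => True))) hX_orbit_7264_7 hX_orbit_7264_8 (fun h => absurd h (by simp only [List.mem_cons, List.not_mem_nil, or_false]; omega)) (fun h => absurd h (by simp only [List.mem_cons, List.not_mem_nil, or_false]; omega)))
  exact rowC2a_a3 227 hℓ (by norm_num) M hP n hn h7 hnℓ hD7264 hD454 m hm hmn
    hS7264
    hS454 x y z hxy1 hxy2

end Summit.Ventures.AbcSig
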